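import Literature.Claims.NS.Faliush2026
import Literature.Analysis.FluidPDE.ExtremeGrowthVorticityControl
import Literature.Analysis.FluidPDE.NSVorticity
import HarnessLib

/-!
# CLAIM C155 — A. Balawi, «Global Regularity for 3D Navier–Stokes via Dyadic Shape, UV Front
# Barrier, and Windowed Duhamel–Grönwall» (Zenodo 17298965, V5 of 2025-10-09, 33 pp.)

Cell `ns-claims` (D-0090), claim **C155**, typist of record `ns-claims-typist-5 g6` (RULINGS v1.36 (6)).
TEXT OF RECORD: Zenodo record 17298965 = V5 (latest; concept 17167901), file
«Navier-Stokes_V5_Ammar-Balawi.pdf», sha256[:16] `c4e628046dd583b4`, 33 pp., PDF page = printed page;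
pin `census/texts/Balawi2025/`. (The V5 RECORD title «Energy–Dissipation Architecture …» and its
description retreat; the V5 PDF keeps the full claim — CARD §1, not a locator.) NOTHING of the paper
is asserted: the claimed statements are `def … : Prop` and the printed steps are `def … (ν : ℝ) :
Prop` (indexed by the viscosity, «for every ν > 0»); the theorems of §D are pure logic plus tree
bridges.

## What is printed (pages of the pin)

* Setting §1.1 p.4: Leray–Hopf solutions (Def 1.1: `u₀ ∈ L²`, `∇·u₀ = 0`, energy inequality (1.4))
  of the unforced system (1.1) on `ℝ³` or `𝕋³`, `ν > 0`; a fixed Littlewood–Paley partition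
  `{P_j}_{j ≥ −1}`, shell energies `E_j = ½‖u_j‖²₂`, `ε_j = 4^j E_j` (1.2), `x_j(I) = ∫_I ε_j` (1.3).
  «All constants that appear later … dependence is only on the fixed LP profile and on ν» (p.4;
  Remark 2.2 p.7; §8 p.25 «C_b, C_par > 0 depend only on the chosen LP cutoffs (not on the
  solution)»).
* Thm 2.1 (informal main result) p.7: «For Leray–Hopf solutions on ℝ³ or 𝕋³, the shape/front/window
  method yields a bound `∫₀ᵀ‖ω(t)‖_{L∞} dt ≲ ∫₀ᵀ‖∇u(t)‖²_{L²} dt < ∞` for every `T > 0`.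
  Consequently, solutions are smooth for all time.»
* Lemma 7.1 (vorticity window estimate) p.19, (7.1), proof p.20–21; Thm 7.3 (window BKM bound)
  p.22, (7.4): on a front-fixed window `[t₀, t₁]` (Def 4.4 p.10: the UV front `J(t)` of Def 4.1 is
  constant), `∫_{t₀}^{t₁}‖ω‖_{L∞} dt ≲ Σ_{j≥−1} x_j = ∫_{t₀}^{t₁} Σ_j 4^jE_j dt ≃ ∫_{t₀}^{t₁}‖∇u‖²_{L²} dt`
  («The first inequality is Lemma 7.1»).
* Cor 7.4 (global BKM finiteness) p.22: «For every `T > 0`, `∫₀ᵀ‖ω(t)‖_{L∞} dt < ∞`. Proof.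
  Partition `[0, T]` into finitely many front-fixed windows (Lemma 4.8). Sum (7.4) over these
  windows: `∫₀ᵀ‖ω‖_∞ ≲ Σ_windows ∫_{t₀}^{t₁}‖∇u‖²₂ = ∫₀ᵀ‖∇u(t)‖²₂ dt ≤ ‖u₀‖²₂/(2ν)`, by the energy
  inequality (1.4).»
* Lemma 7.5 (regularity criteria) p.23: «(i) If `∫₀ᵀ‖ω(t)‖_{L∞} dt < ∞`, then the solution is
  smooth on `[0, T]`» ((ii) Prodi–Serrin). Thm 7.6 p.23: «On the torus 𝕋³, Leray–Hopf solutions are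
  smooth for all `t > 0`. Proof. Combine Corollary 7.4 with Lemma 7.5(i).» Thm 7.7 p.24: «On ℝ³,
  Leray–Hopf solutions are smooth for all `t > 0`» (proof: Cor 7.4 + Lemma 7.5(i) + the low-block
  energy bookkeeping (7.7)–(7.8)).

## How it is typed

* **Claimed statements** (§B): Thm 7.6 / Thm 7.7 say exactly what C141 `Faliush2026` says («every
  global Leray–Hopf weak solution from `L²` divergence-free data agrees for every `t > 0` a.e. with a
  classical solution on `(0, ∞)`», on `𝕋³` and on `ℝ³`); the two `Prop`s are REUSED BY NAME
  (`ClaimedTheorem := Faliush2026.ClaimedTheoremT3 ∧ Faliush2026.ClaimedTheoremR3`), so the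
  tree's proved Clay
  bridges apply verbatim: `clay_of_claimed : ClaimedTheorem → clayR3.Regularity ∧
  clayPeriodic.Regularity` (the claim is STRONGER than (A)/(B): all `L²` data, all Leray–Hopf
  solutions).
* **The load-bearing inequality** (§C, `Step74sum_T3` / `Step74sum_R3`): the window-summed display
  of the proof of Cor 7.4 p.22 (= the bound of Thm 2.1 p.7), `∫₀ᵀ‖ω‖_{L∞} ≤ C ∫₀ᵀ‖∇u‖²_{L²}` for
  every `T > 0`, AT THE PRINTED GRAIN (every global Leray–Hopf weak solution from `L²` data, Def
  1.1 — no smallness, no regularity hypothesis added) and with the PRINTED quantifier order on the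
  constant — `C` depends only on the LP profile and `ν` (p.4, Remark 2.2, §8 p.25 «not on the
  solution»): `∀ ν, ∃ C, ∀ solutions, ∀ T`. Both sides are Lebesgue integrals over `(0, T)` of
  extended-real functions (`bkmT`/`dissT`, `bkmR`/`dissR`; no Bochner junk), the integrands computed
  on the representative with the tree's classical operators (`torusVorticitySqAt = |ω|²`,
  `Torus.gradNormSq`; `curl`, `fderiv`) — honest on differentiable slices, junk `0` elsewhere
  (recorded). The restrictions to the CLASSICAL members of the printed class
  (`Step74sum_T3_classical`, `Step74sum_R3_classical`, where every quantity is honest; e.g. the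
  tree's viscous ABC flows) are implied (`step74sum_T3_classical_of`, `step74sum_R3_classical_of`).
  The per-solution reading `∀ ν, ∀ solution, ∃ C, ∀ T` is NOT printed; it is recorded as
  `Step74sum_T3_perSolution` (the charitable face the REF audits; `perSolution_of_step74sum_T3`);
  the intermediate `C(ν, T)` reading is `Step74sum_T3_perT` (`perT_of_step74sum_T3`).
  `bkm_lt_top_of_step74sum_T3` is the arithmetic by which Cor 7.4 consumes the display.
* **The endgame at the Leray–Hopf grain** (§C): Cor 7.4 (`Cor74_T3`, `Cor74_R3`: BKM finiteness of
  every global Leray–Hopf solution on every `[0, T]`, the vorticity of the representative taken with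
  the tree's classical operators — junk-valued on non-differentiable slices, recorded) and Lemma
  7.5(i) in the form Thm 7.6/7.7 consume it (`Lemma75i_T3`, `Lemma75i_R3`: BKM finiteness on every
  `[0, T]` ⇒ a.e. equal to a classical solution on `(0, ∞)`); `claim_of_steps` composes them into
  `ClaimedTheorem` (every typed endgame step consumed). The ℝ³ low-block bookkeeping (7.5)–(7.8)
  p.23–24 (Grönwall on `‖P_{−1}u‖_{H¹}`) is classical energy arithmetic inside the proof of Thm 7.7
  and is not typed separately.
* **NOT typed (recorded for the REF; all at the Littlewood–Paley level, which needs the paper's LP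
  apparatus — shells `P_j`, shape variables `χ_j` (1.5), the UV front `J(t)` Def 4.1, front-fixed
  windows Def 4.4):** (1.7) p.5 / Lemma A.3 p.29 (the «width-3 paraproduct»
  `‖P_j P∇·(f⊗g)‖₂ ≤ C_par Σ_{|m|≤3} ‖∇f_{j+m}‖₂‖g_{j+m}‖_∞` and `‖P_jT(u,u)‖²₂ ≤ C_par Σ_{|m|≤3} ε_{j+m}`);
  the shell identity (3.1) p.8 and the shape drift (3.2) p.9; the spacing/jump-count Lemmas 4.6–4.8
  p.10–11; the windowed Duhamel (5.2) p.15 and banded Grönwall (5.7)–(5.8) p.16; Lemma 7.1 (7.1)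
  p.19 and Thm 7.3 (7.4) p.22 on a single front-fixed window. Typist's flags (no verdict): (a) both
  sides of (7.4)/Cor 7.4's display carry different amplitude degree (left degree 1, right degree 2 in
  `u`) while the constant is solution-independent — the exact viscous ABC/Beltrami solutions
  `e^{−4π²νt}·abcFlow A B C` of the tree (`Torus.isClassicalNSSolutionOn_abcFlow`; global Leray–Hopf
  by `Torus.IsClassicalNSSolutionOn.isLerayHopfOn_of_convex`) are instances of the typed face at
  every amplitude; (b) Lemma A.3's second display bounds a quantity of degree 4 by one of degree 2,
  and its first display omits the low–high paraproduct interactions (only `|m| ≤ 3` shells of BOTH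
  factors appear); (c) the p.21 «conclusion on the window» still carries the degree-1 homogeneous
  term `(2^{J₀/2}/ν)(Σ_{|m|≤3} E_{J₀+m}(t₀))^{1/2}`, which p.22 l.1–6 absorbs into the window
  dissipation «using Young's inequality … and they telescope across windows».

WHAT THIS IS NOT: not a claim about NS regularity or blow-up; not a claim about any author beyond the
typed locator.
-/

open scoped ContDiff ENNReal NNReal Topology
open _root_.MeasureTheory _root_.Set Function

noncomputable section

namespace Literature.Claims.NS.Balawi2025

open Literature.Analysis.FunctionSpaces Literature.Analysis.FluidPDE Literature.Claims.NS.ClayVariants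

/-! ## A. Vocabulary -/

/-- The flat unit torus `𝕋³`. [folklore] -/
abbrev T3 : Type := UnitAddTorus (Fin 3)

/-- Euclidean `ℝ³`. [folklore] -/
abbrev E3 : Type := EuclideanSpace ℝ (Fin 3)

/-- `‖ω‖_{L∞}` of a field on `𝕋³` as an extended real: `sup_x |ω(x)|` with `|ω(x)|² =
torusVorticitySqAt v x = ½ Σᵢⱼ (∂ᵢvⱼ − ∂ⱼvᵢ)²` (the tree's classical vorticity magnitude; junk `0`
where `v` is not differentiable). [cite: Balawi2025, §1.1 p.4; (7.4) p.22] -/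
def vortSupT (v : T3 → E3) : ℝ≥0∞ := ⨆ x, ENNReal.ofReal (Real.sqrt (torusVorticitySqAt v x))

/-- The BKM integral `∫_a^b ‖ω(t)‖_{L∞} dt` on `𝕋³` (extended real, no side conditions).
[cite: Balawi2025, Thm 2.1 p.7; Cor 7.4 p.22] -/
def bkmT (u : ℝ → T3 → E3) (a b : ℝ) : ℝ≥0∞ := ∫⁻ t in Ioo a b, vortSupT (u t)

/-- The dissipation integral `∫_a^b ‖∇u(t)‖²_{L²} dt` on `𝕋³` (`Torus.gradNormSq = ∫ Σᵢ ‖∂ᵢu‖²`,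
classical). [cite: Balawi2025, (1.4) p.4; (7.4) p.22] -/
def dissT (u : ℝ → T3 → E3) (a b : ℝ) : ℝ≥0∞ :=
  ∫⁻ t in Ioo a b, ENNReal.ofReal (Torus.gradNormSq (u t))

/-- `‖ω‖_{L∞}` of a field on `ℝ³`: `sup_x ‖curl v(x)‖` (extended real; the tree's classical `curl`).
[cite: Balawi2025, §1.1 p.4; Thm 2.1 p.7] -/
def vortSupR (v : E3 → E3) : ℝ≥0∞ := ⨆ x, ‖curl v x‖ₑ

/-- The BKM integral `∫_a^b ‖ω(t)‖_{L∞} dt` on `ℝ³`. [cite: Balawi2025, Thm 2.1 p.7; Cor 7.4 p.22] -/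
def bkmR (u : ℝ → E3 → E3) (a b : ℝ) : ℝ≥0∞ := ∫⁻ t in Ioo a b, vortSupR (u t)

/-- The dissipation integral `∫_a^b ‖∇u(t)‖²_{L²} dt` on `ℝ³` (`‖Du(x)‖` the operator norm of the
Fréchet derivative; comparable to the Frobenius norm within absolute constants).
[cite: Balawi2025, (1.4) p.4; Thm 2.1 p.7] -/
def dissR (u : ℝ → E3 → E3) (a b : ℝ) : ℝ≥0∞ :=
  ∫⁻ t in Ioo a b, ∫⁻ x, ‖fderiv ℝ (u t) x‖ₑ ^ 2

/-! ## B. The claimed statements (nothing asserted) -/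

/-- **CLAIMED THEOREM = Thm 7.6 p.23 ∧ Thm 7.7 p.24** («On the torus 𝕋³, Leray–Hopf solutions are
smooth for all `t > 0`»; «On ℝ³, Leray–Hopf solutions are smooth for all `t > 0`»; Def 1.1 p.4:
`u₀ ∈ L²`, `∇·u₀ = 0`, unforced, `ν > 0`; abstract p.1 «global regularity (smoothness and
uniqueness) for Leray–Hopf solutions on 𝕋³ and ℝ³»): every global Leray–Hopf weak solution from `L²`
weakly divergence-free data agrees for every `t > 0` a.e. with a classical solution on `(0, ∞)`, on
`𝕋³` AND on `ℝ³` — token for token the two statements typed for C141, reused by name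
(`Faliush2026.ClaimedTheoremT3`, `Faliush2026.ClaimedTheoremR3`) so that the tree's proved Clay
bridges apply verbatim. [claim: Balawi2025, status: disputed]
[cite: Balawi2025, Thm 7.6 p.23; Thm 7.7 p.24; Def 1.1 p.4; abstract p.1] -/
def ClaimedTheorem : Prop := Faliush2026.ClaimedTheoremT3 ∧ Faliush2026.ClaimedTheoremR3

/-! ## C. The printed steps (nothing asserted) -/

/-- **Cor 7.4 proof display p.22 = the bound of Thm 2.1 p.7, on 𝕋³, AT THE PRINTED GRAIN with the
PRINTED quantifier order on the constant** («depend only on the fixed LP profile and ν», p.4 /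
Remark 2.2 p.7 / §8 p.25 «not on the solution»): for every `ν > 0` there is `C` such that for EVERY
global Leray–Hopf weak solution `u` of the unforced system on `𝕋³` from `L²` weakly divergence-free
data (Def 1.1 — no smallness, no regularity assumed) and every `T > 0`,
`∫₀ᵀ ‖ω(t)‖_{L∞} dt ≤ C ∫₀ᵀ ‖∇u(t)‖²_{L²} dt` ((7.4) summed over the finitely many front-fixed
windows partitioning `[0, T]`, Lemma 4.8 / Remark 4.5, as printed in the proof of Cor 7.4). Both
sides are Lebesgue integrals of extended-real functions of the representative, computed with the
tree's classical derivative (honest on differentiable slices, junk `0` elsewhere; recorded).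
[claim: Balawi2025, status: disputed]
[cite: Balawi2025, Cor 7.4 proof p.22; Thm 2.1 p.7; (7.4) p.22; Remark 2.2 p.7] -/
def Step74sum_T3 (ν : ℝ) : Prop :=
  0 < ν → ∃ C : ℝ≥0,
    ∀ u₀ : T3 → E3, MemLp u₀ 2 volume → Torus.IsWeaklyDivFree u₀ →
      ∀ u : ℝ → T3 → E3, Torus.IsGlobalLerayHopf ν 0 u₀ u →
        ∀ T : ℝ, 0 < T → bkmT u 0 T ≤ C * dissT u 0 T

/-- **The same display restricted to the classical members of the printed class** (global
Leray–Hopf solutions that are moreover classical on `[0, ∞) × 𝕋³` — e.g. the tree's viscous ABC flows,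
`Torus.isClassicalNSSolutionOn_abcFlow`, Leray–Hopf by
`Torus.IsClassicalNSSolutionOn.isLerayHopfOn_of_convex`): there every typed quantity is the honest
classical one. Implied by `Step74sum_T3` (`step74sum_T3_classical_of`); recorded as the
kernel-decidable face. [claim: Balawi2025, status: disputed]
[cite: Balawi2025, Cor 7.4 proof p.22; Thm 2.1 p.7; Remark 2.2 p.7] -/
def Step74sum_T3_classical (ν : ℝ) : Prop :=
  0 < ν → ∃ C : ℝ≥0,
    ∀ (u : ℝ → T3 → E3) (p : ℝ → T3 → ℝ), MemLp (u 0) 2 volume → Torus.IsWeaklyDivFree (u 0) →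
      Torus.IsGlobalLerayHopf ν 0 (u 0) u → Torus.IsClassicalNSSolutionOn (Ici 0) ν 0 u p →
        ∀ T : ℝ, 0 < T → bkmT u 0 T ≤ C * dissT u 0 T

/-- **The per-solution reading of the same display — NOT printed** (the constant allowed to depend
on the solution and the datum: `∀ ν, ∀ u, ∃ C, ∀ T`; Remark 2.2 excludes it); recorded as the
charitable face for the referee (`perSolution_of_step74sum_T3`). [claim: Balawi2025, status: disputed]
[cite: Balawi2025, Cor 7.4 proof p.22; Remark 2.2 p.7] -/
def Step74sum_T3_perSolution (ν : ℝ) : Prop :=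
  0 < ν →
    ∀ u₀ : T3 → E3, MemLp u₀ 2 volume → Torus.IsWeaklyDivFree u₀ →
      ∀ u : ℝ → T3 → E3, Torus.IsGlobalLerayHopf ν 0 u₀ u →
        ∃ C : ℝ≥0, ∀ T : ℝ, 0 < T → bkmT u 0 T ≤ C * dissT u 0 T

/-- **Intermediate charitable reading — the constant allowed to depend on `ν` AND on the horizon
`T`** (`∀ ν, ∀ T, ∃ C, ∀ solutions`; not printed — Remark 2.2 — but weaker than the printed order and
still uniform in the solution); implied by `Step74sum_T3` (`perT_of_step74sum_T3`).
[claim: Balawi2025, status: disputed] [cite: Balawi2025, Cor 7.4 proof p.22; Remark 2.2 p.7] -/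
def Step74sum_T3_perT (ν : ℝ) : Prop :=
  0 < ν → ∀ T : ℝ, 0 < T → ∃ C : ℝ≥0,
    ∀ u₀ : T3 → E3, MemLp u₀ 2 volume → Torus.IsWeaklyDivFree u₀ →
      ∀ u : ℝ → T3 → E3, Torus.IsGlobalLerayHopf ν 0 u₀ u → bkmT u 0 T ≤ C * dissT u 0 T

/-- **Cor 7.4 proof display p.22 = the bound of Thm 2.1 p.7, on ℝ³, at the printed grain,
constants as printed**: for every `ν > 0` there is `C` such that for every global Leray–Hopf weak
solution `u` of the unforced system on `ℝ³` from `L²` weakly divergence-free data and every `T > 0`,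
`∫₀ᵀ‖ω‖_{L∞} ≤ C ∫₀ᵀ‖∇u‖²_{L²}`. [claim: Balawi2025, status: disputed]
[cite: Balawi2025, Cor 7.4 proof p.22; Thm 2.1 p.7; Thm 7.7 p.24] -/
def Step74sum_R3 (ν : ℝ) : Prop :=
  0 < ν → ∃ C : ℝ≥0,
    ∀ u₀ : E3 → E3, MemLp u₀ 2 volume → IsWeaklyDivFree u₀ →
      ∀ u : ℝ → E3 → E3, IsGlobalLerayHopf ν 0 u₀ u →
        ∀ T : ℝ, 0 < T → bkmR u 0 T ≤ C * dissR u 0 T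

/-- **The ℝ³ display restricted to the classical members of the printed class** (global Leray–Hopf
AND classical on `[0, ∞) × ℝ³`); implied by `Step74sum_R3` (`step74sum_R3_classical_of`).
[claim: Balawi2025, status: disputed] [cite: Balawi2025, Cor 7.4 proof p.22; Thm 2.1 p.7] -/
def Step74sum_R3_classical (ν : ℝ) : Prop :=
  0 < ν → ∃ C : ℝ≥0,
    ∀ (u : ℝ → E3 → E3) (p : ℝ → E3 → ℝ), MemLp (u 0) 2 volume → IsWeaklyDivFree (u 0) →
      IsGlobalLerayHopf ν 0 (u 0) u → IsClassicalNSSolutionOn (Ici 0) ν 0 u p →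
        ∀ T : ℝ, 0 < T → bkmR u 0 T ≤ C * dissR u 0 T

/-- **Cor 7.4 p.22 (global BKM finiteness), 𝕋³, as printed at the Leray–Hopf grain**: every global
Leray–Hopf solution from `L²` weakly divergence-free data has `∫₀ᵀ‖ω(t)‖_{L∞} dt < ∞` for every
`T > 0` (vorticity of the representative with the tree's classical derivative — honest on
differentiable slices, junk `0` elsewhere; recorded). [claim: Balawi2025, status: disputed]
[cite: Balawi2025, Cor 7.4 p.22] -/
def Cor74_T3 (ν : ℝ) : Prop :=
  0 < ν → ∀ u₀ : T3 → E3, MemLp u₀ 2 volume → Torus.IsWeaklyDivFree u₀ →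
    ∀ u : ℝ → T3 → E3, Torus.IsGlobalLerayHopf ν 0 u₀ u → ∀ T : ℝ, 0 < T → bkmT u 0 T < ⊤

/-- **Cor 7.4 p.22, ℝ³, at the Leray–Hopf grain.** [claim: Balawi2025, status: disputed]
[cite: Balawi2025, Cor 7.4 p.22; Thm 7.7 p.24] -/
def Cor74_R3 (ν : ℝ) : Prop :=
  0 < ν → ∀ u₀ : E3 → E3, MemLp u₀ 2 volume → IsWeaklyDivFree u₀ →
    ∀ u : ℝ → E3 → E3, IsGlobalLerayHopf ν 0 u₀ u → ∀ T : ℝ, 0 < T → bkmR u 0 T < ⊤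

/-- **Lemma 7.5(i) p.23 as used in Thm 7.6** («If `∫₀ᵀ‖ω‖_{L∞} dt < ∞`, then the solution is
smooth on `[0, T]`»; for a Leray–Hopf solution on `𝕋³`, BKM finiteness on every `[0, T]` gives a
classical solution on `(0, ∞)` agreeing with it a.e. at every `t > 0`).
[claim: Balawi2025, status: disputed] [cite: Balawi2025, Lemma 7.5(i) p.23; Thm 7.6 p.23] -/
def Lemma75i_T3 (ν : ℝ) : Prop :=
  0 < ν → ∀ u₀ : T3 → E3, MemLp u₀ 2 volume → Torus.IsWeaklyDivFree u₀ →
    ∀ u : ℝ → T3 → E3, Torus.IsGlobalLerayHopf ν 0 u₀ u → (∀ T : ℝ, 0 < T → bkmT u 0 T < ⊤) →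
      ∃ (U : ℝ → T3 → E3) (P : ℝ → T3 → ℝ),
        Torus.IsClassicalNSSolutionOn (Ioi 0) ν 0 U P ∧ ∀ t : ℝ, 0 < t → U t =ᵐ[volume] u t

/-- **Lemma 7.5(i) p.23 as used in Thm 7.7** (ℝ³ twin). [claim: Balawi2025, status: disputed]
[cite: Balawi2025, Lemma 7.5(i) p.23; Thm 7.7 p.24] -/
def Lemma75i_R3 (ν : ℝ) : Prop :=
  0 < ν → ∀ u₀ : E3 → E3, MemLp u₀ 2 volume → IsWeaklyDivFree u₀ →
    ∀ u : ℝ → E3 → E3, IsGlobalLerayHopf ν 0 u₀ u → (∀ T : ℝ, 0 < T → bkmR u 0 T < ⊤) →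
      ∃ (U : ℝ → E3 → E3) (P : ℝ → E3 → ℝ),
        IsClassicalNSSolutionOn (Ioi 0) ν 0 U P ∧ ∀ t : ℝ, 0 < t → U t =ᵐ[volume] u t

/-! ## D. Kernel-checked relations (pure logic + tree bridges; nothing of the paper is asserted) -/

/-- **Thm 7.6 p.23** («Combine Corollary 7.4 with Lemma 7.5(i)»): PROVED composition on `𝕋³`.
[cite: Balawi2025, Thm 7.6 p.23] -/
theorem claimT3_of_steps (h74 : ∀ ν, Cor74_T3 ν) (h75 : ∀ ν, Lemma75i_T3 ν) :
    Faliush2026.ClaimedTheoremT3 :=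
  fun ν hν u₀ hu₀ hdiv u hu => h75 ν hν u₀ hu₀ hdiv u hu (h74 ν hν u₀ hu₀ hdiv u hu)

/-- **Thm 7.7 p.24** (Cor 7.4 + Lemma 7.5(i); the low-block bookkeeping (7.7)–(7.8) is inside the
proof of the typed Lemma 7.5(i) face): PROVED composition on `ℝ³`. [cite: Balawi2025, Thm 7.7 p.24] -/
theorem claimR3_of_steps (h74 : ∀ ν, Cor74_R3 ν) (h75 : ∀ ν, Lemma75i_R3 ν) :
    Faliush2026.ClaimedTheoremR3 :=
  fun ν hν u₀ hu₀ hdiv u hu => h75 ν hν u₀ hu₀ hdiv u hu (h74 ν hν u₀ hu₀ hdiv u hu)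

/-- **COMPOSITION** — every typed endgame step consumed. [cite: Balawi2025, §7.3 p.23–24] -/
theorem claim_of_steps (h74T : ∀ ν, Cor74_T3 ν) (h75T : ∀ ν, Lemma75i_T3 ν)
    (h74R : ∀ ν, Cor74_R3 ν) (h75R : ∀ ν, Lemma75i_R3 ν) : ClaimedTheorem :=
  ⟨claimT3_of_steps h74T h75T, claimR3_of_steps h74R h75R⟩

/-- The printed quantifier order (profile/ν-only constant) implies the per-solution reading; the
converse is not claimed. [cite: Balawi2025, Remark 2.2 p.7] -/
theorem perSolution_of_step74sum_T3 {ν : ℝ} (h : Step74sum_T3 ν) :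
    Step74sum_T3_perSolution ν := by
  intro hν u₀ hu₀ hdiv u hu
  obtain ⟨C, hC⟩ := h hν
  exact ⟨C, hC u₀ hu₀ hdiv u hu⟩

/-- The printed order implies the `C(ν, T)` reading (pure logic). [cite: Balawi2025, Remark 2.2 p.7] -/
theorem perT_of_step74sum_T3 {ν : ℝ} (h : Step74sum_T3 ν) : Step74sum_T3_perT ν := by
  intro hν T hT
  obtain ⟨C, hC⟩ := h hν
  exact ⟨C, fun u₀ hu₀ hdiv u hu => hC u₀ hu₀ hdiv u hu T hT⟩

/-- The printed-grain display implies its restriction to classical members (pure logic).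
[cite: Balawi2025, Cor 7.4 proof p.22] -/
theorem step74sum_T3_classical_of {ν : ℝ} (h : Step74sum_T3 ν) :
    Step74sum_T3_classical ν := by
  intro hν
  obtain ⟨C, hC⟩ := h hν
  exact ⟨C, fun u _p h0 hdiv hLH _hcl T hT => hC (u 0) h0 hdiv u hLH T hT⟩

/-- ℝ³ twin of `step74sum_T3_classical_of`. [cite: Balawi2025, Cor 7.4 proof p.22] -/
theorem step74sum_R3_classical_of {ν : ℝ} (h : Step74sum_R3 ν) :
    Step74sum_R3_classical ν := by
  intro hν
  obtain ⟨C, hC⟩ := h hν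
  exact ⟨C, fun u _p h0 hdiv hLH _hcl T hT => hC (u 0) h0 hdiv u hLH T hT⟩

/-- **How Cor 7.4 consumes the display** (p.22: «… = ∫₀ᵀ‖∇u(t)‖²₂ dt ≤ ‖u₀‖²₂/(2ν), by the energy
inequality (1.4). Hence the BKM integral is finite»): under `Step74sum_T3`, finiteness of the
dissipation integral on `[0, T]` gives BKM finiteness on `[0, T]` (extended-real arithmetic).
[cite: Balawi2025, Cor 7.4 proof p.22] -/
theorem bkm_lt_top_of_step74sum_T3 {ν : ℝ} (h : Step74sum_T3 ν) (hν : 0 < ν) {u₀ : T3 → E3}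
    (hu₀ : MemLp u₀ 2 volume) (hdiv : Torus.IsWeaklyDivFree u₀) {u : ℝ → T3 → E3}
    (hu : Torus.IsGlobalLerayHopf ν 0 u₀ u) {T : ℝ} (hT : 0 < T) (hfin : dissT u 0 T < ⊤) :
    bkmT u 0 T < ⊤ := by
  obtain ⟨C, hC⟩ := h hν
  exact lt_of_le_of_lt (hC u₀ hu₀ hdiv u hu T hT) (ENNReal.mul_lt_top ENNReal.coe_lt_top hfin)

/-- **CLAY READING — PROVED**: the claimed theorem implies Fefferman's (A) and (B) (tree bridges of
C141: `Faliush2026.clay_of_claimed`, i.e. `clayR3_regularity_iff_lerayHopf_locallyBounded` and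
`clayPeriodic_regularity_iff_lerayHopf_boundedFromLeft`). [cite: Balawi2025, Thm 7.6 p.23; Thm 7.7 p.24]
[cite: FeffermanClay2006, (A), (B) p.2] -/
theorem clay_of_claimed (h : ClaimedTheorem) : clayR3.Regularity ∧ clayPeriodic.Regularity :=
  Faliush2026.clay_of_claimed ⟨h.2, h.1⟩

end Literature.Claims.NS.Balawi2025

end

-- WHAT THIS IS NOT: not a claim about NS regularity or blow-up; not a claim about any author beyond the typed locator.
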